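import Mathlib
import Summits.Ventures.PercRepro2.CoinChainTower
import Summits.Ventures.PercRepro2.CoinKSureGen

/-!
# The sure-coin closure of a level along an OR-tower, and the tower reduction for ANY summand
(blind cell PercRepro2, night-2 g18; proofs/NIGHT2-DARC.md §58.9)

`clSet L W` is the level of the tower core reached from the level `W ⊆ U` when every coin of
the tower `L` is sure: each listed vertex is inserted iff the growing level meets its entries
(bottom vertex first).  `clSet` is monotone and a join-homomorphism (`clSet_union`), the closure
of a level of `U` lies in the tower core, and a non-tower vertex lies in the closure iff it lies
in the level.  **`OrTower.sum_close`**: for sure coins the sums over the levels of the tower core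
of ANY summand `G` reduce to sums over the levels of `U` of `G` at the closed level — the tower
reduction of §57.11 (`sum_tower`) with no invariance of the marker required; it is what the
marker at a MIDDLE tower vertex needs (`CoinChainTowerMarkerMid.lean`).
-/

namespace Summit.Ventures.PercRepro2.Coin

open Classical

section CloseSet

variable {V : Type*} {E : Type*} [DecidableEq V]

/-- The sure-coin closure of a level along a tower list: each listed vertex is inserted iff the
growing level meets its entries (bottom vertex first). -/
def clSet : List (Finset V × (V → E) × V) → Finset V → Finset V
  | [], W => W
  | x :: rest, W => clSet rest (if ∃ r ∈ x.1, r ∈ W then W ∪ {x.2.2} else W)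

/-- `clSet` is monotone. -/
lemma clSet_mono : ∀ (L : List (Finset V × (V → E) × V)) {S T : Finset V}, S ⊆ T →
    clSet L S ⊆ clSet L T
  | [], _, _, hST => hST
  | x :: rest, S, T, hST => by
      simp only [clSet]
      apply clSet_mono rest
      by_cases hS : ∃ r ∈ x.1, r ∈ S
      · obtain ⟨r, hr, hrS⟩ := hS
        rw [if_pos ⟨r, hr, hrS⟩, if_pos ⟨r, hr, hST hrS⟩]
        exact Finset.union_subset_union_left hST
      · rw [if_neg hS]
        split_ifs
        · exact hST.trans Finset.subset_union_left
        · exact hST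

/-- `clSet` is a join-homomorphism. -/
lemma clSet_union : ∀ (L : List (Finset V × (V → E) × V)) (S T : Finset V),
    clSet L (S ∪ T) = clSet L S ∪ clSet L T
  | [], _, _ => rfl
  | x :: rest, S, T => by
      simp only [clSet]
      rw [← clSet_union rest]
      congr 1
      by_cases hS : ∃ r ∈ x.1, r ∈ S <;> by_cases hT : ∃ r ∈ x.1, r ∈ T
      · obtain ⟨r, hr, hrS⟩ := hS
        have hST : ∃ r ∈ x.1, r ∈ S ∪ T := ⟨r, hr, Finset.mem_union_left T hrS⟩
        rw [if_pos hST, if_pos ⟨r, hr, hrS⟩, if_pos hT]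
        ext z; simp only [Finset.mem_union, Finset.mem_singleton]; tauto
      · obtain ⟨r, hr, hrS⟩ := hS
        have hST : ∃ r ∈ x.1, r ∈ S ∪ T := ⟨r, hr, Finset.mem_union_left T hrS⟩
        rw [if_pos hST, if_pos ⟨r, hr, hrS⟩, if_neg hT]
        ext z; simp only [Finset.mem_union, Finset.mem_singleton]; tauto
      · obtain ⟨r, hr, hrT⟩ := hT
        have hST : ∃ r ∈ x.1, r ∈ S ∪ T := ⟨r, hr, Finset.mem_union_right S hrT⟩
        rw [if_pos hST, if_neg hS, if_pos ⟨r, hr, hrT⟩]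
        ext z; simp only [Finset.mem_union, Finset.mem_singleton]; tauto
      · have hST : ¬ ∃ r ∈ x.1, r ∈ S ∪ T := by
          rintro ⟨r, hr, hrST⟩
          rcases Finset.mem_union.1 hrST with h | h
          · exact hS ⟨r, hr, h⟩
          · exact hT ⟨r, hr, h⟩
        rw [if_neg hST, if_neg hS, if_neg hT]

/-- The closure of a level of `U` lies in the tower core. -/
lemma clSet_subset_towerCore : ∀ (L : List (Finset V × (V → E) × V)) (U W : Finset V),
    W ⊆ U → clSet L W ⊆ towerCore U L
  | [], _, _, hWU => hWU
  | x :: rest, U, W, hWU => by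
      simp only [clSet, towerCore]
      apply clSet_subset_towerCore rest
      split_ifs
      · intro z hz
        rcases Finset.mem_union.1 hz with h | h
        · exact Finset.mem_insert_of_mem (hWU h)
        · rw [Finset.mem_singleton] at h; rw [h]; exact Finset.mem_insert_self _ _
      · exact hWU.trans (Finset.subset_insert _ _)

/-- A vertex that is not a tower vertex lies in the closure iff it lies in the level. -/
lemma mem_clSet_iff : ∀ (L : List (Finset V × (V → E) × V)) (W : Finset V) {z : V},
    (∀ x ∈ L, z ≠ x.2.2) → (z ∈ clSet L W ↔ z ∈ W)
  | [], _, _, _ => Iff.rfl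
  | x :: rest, W, z, hz => by
      simp only [clSet]
      rw [mem_clSet_iff rest _ (fun y hy => hz y (List.mem_cons_of_mem _ hy))]
      have hzx : z ≠ x.2.2 := hz x List.mem_cons_self
      split_ifs
      · simp only [Finset.mem_union, Finset.mem_singleton, hzx, or_false]
      · exact Iff.rfl

end CloseSet

section SumClose

variable {V : Type*} {E : Type*} [Fintype V] [DecidableEq V] [Fintype E] [DecidableEq E]
  {R : Type*} [Field R] [LinearOrder R] [IsStrictOrderedRing R]
  {arcs : E → Finset (V × V)} {s : V}

omit [Fintype V] [LinearOrder R] [IsStrictOrderedRing R] in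
/-- **The sure-coin tower reduction for an arbitrary summand**: the sums over the levels of the
tower core reduce to sums over the levels of `U` of the summand at the closed level. -/
lemma OrTower.sum_close {U : Finset V} {L : List (Finset V × (V → E) × V)}
    (hT : OrTower arcs s U L) (pr : E → R) (hsure : ∀ x ∈ L, ∀ r ∈ x.1, pr (x.2.1 r) = 1)
    (G : Finset V → R) :
    ∑ W ∈ (towerCore U L).powerset, prob pr (coreLevel arcs s (towerCore U L) W) * G W =
      ∑ W ∈ U.powerset, prob pr (coreLevel arcs s U W) * G (clSet L W) := by
  induction hT generalizing G with
  | nil U => rfl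
  | cons U ent c v rest h _ ih =>
    have hsure' : ∀ x ∈ rest, ∀ r ∈ x.1, pr (x.2.1 r) = 1 :=
      fun x hx => hsure x (List.mem_cons_of_mem _ hx)
    have hsure₀ : ∀ r ∈ ent, pr (c r) = 1 := hsure (ent, c, v) List.mem_cons_self
    simp only [towerCore, clSet]
    rw [ih hsure' G]
    have step := h.sum_gen pr (fun W => G (clSet rest W)) (fun _ => (1 : R)) (fun _ => rfl)
    simp only [mul_one] at step
    rw [step]
    refine Finset.sum_congr rfl fun W _ => ?_
    rw [closeB_of_sure pr c v (fun W => G (clSet rest W)) hsure₀ W]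
    unfold closeB
    split_ifs <;> rfl

end SumClose


end Summit.Ventures.PercRepro2.Coin
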